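import Literature.MathematicalPhysics.QuantumLattice.SpinEmbedding
import Mathlib.LinearAlgebra.Matrix.PosDef
import HarnessLib

/-!
# Partial traces (reduced density matrices) of a finite quantum spin system along a site injection

Family `hubbard` (topic `MathematicalPhysics/QuantumLattice`; serves the sr-mbsolver lane-B
"LTI transport", LEAN-MAP §6 R7). The spin-system vocabulary of the tree is `TensorIndex Λ q = Λ → Fin q`
(product-basis configurations), `Op Λ q = Matrix (TensorIndex Λ q) (TensorIndex Λ q) ℂ` (the local algebra
`𝔄_Λ = B(⊗_{x∈Λ} ℂ^q)`, `SpinSystem`) and, for an injection of sites `φ : X ↪ Y`, the unital `*`-homomorphism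
`spinEmbed φ : 𝔄_X → 𝔄_Y`, `A ↦ A ⊗ 𝟙_{Y∖φ(X)}` (`SpinEmbedding`). This file adds the map in the opposite
direction on DENSITY MATRICES: the **partial trace over the sites outside the range of `φ`**,

  `spinPartialTrace φ : 𝔄_Y →ₗ[ℂ] 𝔄_X`,  `tr (A · spinPartialTrace φ σ) = tr ((spinEmbed φ A) · σ)`  for all `A ∈ 𝔄_X`,

i.e. the Hilbert–Schmidt adjoint of `spinEmbed φ` — Nielsen–Chuang's reduced density operator
`ρ^A = tr_B ρ^{AB}`, characterised by `tr(M ρ^A) = tr((M ⊗ I_B) ρ^{AB})` (their eq. (2.180); uniqueness Box 2.6),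
written for an arbitrary sub-tensor-factor `X ↪ Y` of a lattice spin system (Bratteli–Robinson II §6.2.1: the
restriction `ω|_{𝔄_Λ}` of a state to a local algebra). PROVED here: the defining duality and uniqueness
(`trace_mul_spinPartialTrace`, `eq_spinPartialTrace_of_forall_trace_mul`); `*`-compatibility, trace
preservation and preservation of positive semidefiniteness (`conjTranspose_spinPartialTrace`,
`trace_spinPartialTrace`, `posSemidef_spinPartialTrace` — density matrices go to density matrices);
functoriality = CONSISTENCY OF MARGINALS `tr_{Z∖X} = tr_{Y∖X} ∘ tr_{Z∖Y}` (`spinPartialTrace_trans`), the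
bijective case (`spinPartialTrace_equiv`: a mere relabelling), COVARIANCE under the permutation unitaries of
site bijections (`spinPartialTrace_permOp_mul_mul_conjTranspose`) and hence, for a state commuting with a
lattice symmetry `e`, equality of the marginals on `φ(X)` and `e(φ(X))` (`spinPartialTrace_trans_equiv_of_commute`)
— for a translation-invariant state of a ring and consecutive windows this is exactly the "locally translation
invariant" (LTI) condition `tr_L ρ^{(m)} = tr_R ρ^{(m)}` of Kull–Schuch–Dive–Navascués §2.1–2.2
(`spinPartialTrace_succ_eq_castSucc_of_commute`, with `tr_L = spinPartialTrace (Fin.succEmb m)` and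
`tr_R = spinPartialTrace Fin.castSuccEmb` made explicit entrywise in `spinPartialTrace_succEmb_apply` /
`spinPartialTrace_castSuccEmb_apply`); the vector-state and state-functional forms
(`spinPartialTrace_vecMulVec_apply`, `densityAlong`, `trace_mul_densityAlong`, `posSemidef_densityAlong`).
No named facts are introduced; the two definitions (`spinPartialTrace`, `densityAlong`) have bodies.

## References
* M. A. Nielsen, I. L. Chuang, *Quantum Computation and Quantum Information* (10th anniversary ed., CUP 2010),
  §2.4.3 "The reduced density operator", eqs. (2.177)–(2.178) (definition of `tr_B`), Box 2.6, eqs. (2.180)–(2.182)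
  (`tr(M ρ^A) = tr((M ⊗ I_B) ρ^{AB})` and uniqueness), pp. 105–107. [cite: NielsenChuang2010, §2.4.3]
* O. Bratteli, D. W. Robinson, *Operator Algebras and Quantum Statistical Mechanics II*, 2nd ed. (Springer 1997),
  §6.2.1 (local structure `Λ ↦ 𝔄_Λ = ⊗_{x∈Λ} M_q`, isotony, covariance under lattice symmetries; states by
  restriction). [cite: BratteliRobinsonII1997, §6.2.1]
* O. Bratteli, D. W. Robinson, *Operator Algebras and Quantum Statistical Mechanics I*, 2nd ed. (Springer 1987),
  §2.3.2, Lemma 2.3.10(a) / Prop. 2.3.11(a) (a positive functional is Hermitian). [cite: BratteliRobinsonI1987, Lemma 2.3.10]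
* I. Kull, N. Schuch, B. Dive, M. Navascués, *Lower bounding ground-state energies of local Hamiltonians through
  the renormalization group*, Phys. Rev. X 14, 021008 (2024) = arXiv:2212.03014, §2.1–2.2 (reduced states
  `ρ^{(m-1)} = tr_L ρ^{(m)} = tr_R ρ^{(m)}` of a translation-invariant state; the LTI condition and the LTI
  problem `E_LTI(n)`). [cite: KullEtAl2024, §2.1–2.2]

## Mathlib / tree
Used: `Matrix.single` and `Matrix.matrix_eq_sum_single` (matrix units), `Matrix.trace_mul_comm`,
`Matrix.PosSemidef.of_dotProduct_mulVec_nonneg`, `Matrix.PosSemidef.mul_mul_conjTranspose_same`,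
`Matrix.PosSemidef.trace_nonneg`, `Matrix.vecMulVec` algebra; tree: `spinEmbed` and its functoriality /
covariance (`spinEmbed_spinEmbed`, `spinEmbed_equiv`, `permOp_conj_spinEmbed`, `spinEmbed_conjTranspose`),
`permOp`, `reindexOp`. Mathlib has no partial trace of matrices; the tree's
`Literature.Computability.QuantumComplexity.traceLeft/traceRight` (QuantumMarginals) is the bipartite
product-index special case `Matrix (m × n) (m × n) R`, without positivity.
-/

noncomputable section

namespace Literature.MathematicalPhysics.QuantumLattice

open Matrix Finset
open scoped ComplexOrder BigOperators

/-! ### A trace identity for matrix units -/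

section TraceSingle

variable {n : Type*} [Fintype n] [DecidableEq n]

/-- `tr (E_{ij}(c) · M) = c · M_{ji}` for the matrix unit `E_{ij}(c) = Matrix.single i j c` (the pairing of
matrix units with `M` that underlies eq. (2.178)). [cite: NielsenChuang2010, §2.4.3 eq. (2.178)] -/
theorem trace_single_mul (i j : n) (c : ℂ) (M : Matrix n n ℂ) :
    (Matrix.single i j c * M).trace = c * M j i := by
  simp only [Matrix.trace, Matrix.diag_apply]
  rw [Finset.sum_eq_single_of_mem i (Finset.mem_univ i) (fun k _ hk => by simp [hk])]
  simp

end TraceSingle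

section PartialTrace

variable {X Y Z : Type*} [Fintype X] [DecidableEq X] [Fintype Y] [DecidableEq Y]
  [Fintype Z] [DecidableEq Z] {q : ℕ}

/-! ### The partial trace along a site injection -/

/-- **Partial trace over the sites outside the range of `φ : X ↪ Y`** (reduced density matrix on the
sub-tensor-factor `X`): the linear map `𝔄_Y → 𝔄_X` with matrix entries
`(spinPartialTrace φ σ)_{ts} = tr (Γ_φ(E_{st}) · σ)`, `E_{st} = |s⟩⟨t|` the matrix unit and `Γ_φ = spinEmbed φ`;
equivalently (`trace_mul_spinPartialTrace`) the unique operator `ρ^X` with `tr(A ρ^X) = tr((A ⊗ 𝟙) σ)` for all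
`A ∈ 𝔄_X` — Nielsen–Chuang's `ρ^A = tr_B(ρ^{AB})`. [cite: NielsenChuang2010, §2.4.3 eqs. (2.177)–(2.180)] -/
def spinPartialTrace (φ : X ↪ Y) : Op Y q →ₗ[ℂ] Op X q where
  toFun σ := Matrix.of fun t s => (spinEmbed φ (Matrix.single s t (1 : ℂ)) * σ).trace
  map_add' σ τ := by
    ext t s
    simp only [Matrix.of_apply, Matrix.mul_add, Matrix.trace_add, Matrix.add_apply]
  map_smul' c σ := by
    ext t s
    simp only [Matrix.of_apply, Matrix.mul_smul, Matrix.trace_smul, Matrix.smul_apply, RingHom.id_apply]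

/-- Entries of the partial trace (definitional unfolding): `(tr_{Y∖X} σ)_{ts} = tr (Γ_φ(|s⟩⟨t|) σ)`.
[cite: NielsenChuang2010, §2.4.3 eq. (2.178)] -/
theorem spinPartialTrace_apply (φ : X ↪ Y) (σ : Op Y q) (t s : TensorIndex X q) :
    spinPartialTrace φ σ t s = (spinEmbed φ (Matrix.single s t (1 : ℂ)) * σ).trace := rfl

/-- **Defining duality** (Nielsen–Chuang eq. (2.180)): `tr (A · tr_{Y∖X} σ) = tr ((A ⊗ 𝟙_{Y∖X}) · σ)` for every
`A ∈ 𝔄_X`, i.e. `spinPartialTrace φ` is the Hilbert–Schmidt adjoint of `spinEmbed φ`.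
[cite: NielsenChuang2010, §2.4.3 Box 2.6 eq. (2.180)] -/
theorem trace_mul_spinPartialTrace (φ : X ↪ Y) (A : Op X q) (σ : Op Y q) :
    (A * spinPartialTrace φ σ).trace = (spinEmbed φ A * σ).trace := by
  conv_rhs => rw [Matrix.matrix_eq_sum_single A]
  simp only [map_sum, Finset.sum_mul, Matrix.trace_sum]
  rw [Matrix.trace]
  simp only [Matrix.diag_apply, Matrix.mul_apply]
  refine Finset.sum_congr rfl fun s _ => Finset.sum_congr rfl fun t _ => ?_
  have h1 : Matrix.single s t (A s t) = A s t • Matrix.single s t (1 : ℂ) := by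
    rw [Matrix.smul_single, smul_eq_mul, mul_one]
  rw [h1, map_smul, Matrix.smul_mul, Matrix.trace_smul, smul_eq_mul, spinPartialTrace_apply]

/-- **Uniqueness** (Nielsen–Chuang Box 2.6, eqs. (2.181)–(2.182)): an operator `R ∈ 𝔄_X` reproducing all the
expectations `tr (A R) = tr ((A ⊗ 𝟙) σ)` IS the partial trace. [cite: NielsenChuang2010, §2.4.3 Box 2.6] -/
theorem eq_spinPartialTrace_of_forall_trace_mul (φ : X ↪ Y) (σ : Op Y q) {R : Op X q}
    (h : ∀ A : Op X q, (A * R).trace = (spinEmbed φ A * σ).trace) : R = spinPartialTrace φ σ := by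
  ext t s
  rw [spinPartialTrace_apply, ← h, trace_single_mul, one_mul]

/-! ### `*`-compatibility, trace and positivity: density matrices go to density matrices -/

/-- `(tr_{Y∖X} σ)ᴴ = tr_{Y∖X} (σᴴ)`. [cite: NielsenChuang2010, §2.4.3] -/
theorem conjTranspose_spinPartialTrace (φ : X ↪ Y) (σ : Op Y q) :
    (spinPartialTrace φ σ)ᴴ = spinPartialTrace φ σᴴ := by
  ext t s
  rw [Matrix.conjTranspose_apply, spinPartialTrace_apply, spinPartialTrace_apply,
    ← Matrix.trace_conjTranspose, Matrix.conjTranspose_mul, ← spinEmbed_conjTranspose,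
    Matrix.conjTranspose_single, star_one, Matrix.trace_mul_comm]

/-- The partial trace of a Hermitian operator is Hermitian. [cite: NielsenChuang2010, §2.4.3] -/
theorem isHermitian_spinPartialTrace (φ : X ↪ Y) {σ : Op Y q} (hσ : σ.IsHermitian) :
    (spinPartialTrace φ σ).IsHermitian := by
  rw [Matrix.IsHermitian, conjTranspose_spinPartialTrace, hσ.eq]

/-- **The partial trace preserves the trace**: `tr (tr_{Y∖X} σ) = tr σ`. [cite: NielsenChuang2010, §2.4.3] -/
theorem trace_spinPartialTrace (φ : X ↪ Y) (σ : Op Y q) : (spinPartialTrace φ σ).trace = σ.trace := by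
  have h := trace_mul_spinPartialTrace φ (1 : Op X q) σ
  rwa [one_mul, map_one, one_mul] at h

/-- Positivity of the state `A ↦ tr (A σ)` of a positive semidefinite `σ`: `0 ≤ tr (Bᴴ B σ)`.
[cite: BratteliRobinsonI1987, §2.3.2] -/
theorem trace_conjTranspose_mul_self_mul_nonneg {σ : Op Y q} (hσ : σ.PosSemidef) (B : Op Y q) :
    0 ≤ (Bᴴ * B * σ).trace := by
  rw [← Matrix.trace_mul_cycle B σ Bᴴ]
  exact (hσ.mul_mul_conjTranspose_same B).trace_nonneg

/-- The rank-one form `x ⊗ x̄ = |x⟩⟨x|` is a `Bᴴ B` (with `B = |u⟩⟨x|` for any basis label `u`). [folklore] -/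
private theorem vecMulVec_star_eq_conjTranspose_mul (u : TensorIndex X q) (x : TensorIndex X q → ℂ) :
    Matrix.vecMulVec x (star x) =
      (Matrix.vecMulVec (Pi.single u 1 : TensorIndex X q → ℂ) (star x))ᴴ *
        Matrix.vecMulVec (Pi.single u 1 : TensorIndex X q → ℂ) (star x) := by
  classical
  have hs : star (Pi.single u 1 : TensorIndex X q → ℂ) = Pi.single u 1 := by
    ext j; by_cases h : j = u <;> simp [h]
  rw [Matrix.conjTranspose_vecMulVec, star_star, hs, Matrix.vecMulVec_mul_vecMulVec, single_dotProduct,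
    one_mul, Pi.single_eq_same, one_smul]

/-- **The partial trace preserves positive semidefiniteness** (density matrices are sent to density
matrices): `σ ⪰ 0 → tr_{Y∖X} σ ⪰ 0`. Proof: `xᴴ (tr σ) x = tr (Γ_φ(|x⟩⟨x|) σ) = tr ((Γ_φ B)ᴴ (Γ_φ B) σ) ≥ 0`.
[cite: NielsenChuang2010, §2.4.3] -/
theorem posSemidef_spinPartialTrace (φ : X ↪ Y) {σ : Op Y q} (hσ : σ.PosSemidef) :
    (spinPartialTrace φ σ).PosSemidef := by
  refine Matrix.PosSemidef.of_dotProduct_mulVec_nonneg (isHermitian_spinPartialTrace φ hσ.isHermitian)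
    fun x => ?_
  have h1 : star x ⬝ᵥ (spinPartialTrace φ σ *ᵥ x) = (Matrix.vecMulVec x (star x) * spinPartialTrace φ σ).trace := by
    rw [Matrix.trace_mul_comm, Matrix.mul_vecMulVec, Matrix.trace_vecMulVec, dotProduct_comm]
  rw [h1, trace_mul_spinPartialTrace]
  rcases isEmpty_or_nonempty (TensorIndex X q) with hE | ⟨⟨u⟩⟩
  · have h0 : Matrix.vecMulVec x (star x) = 0 := by ext i; exact isEmptyElim i
    rw [h0, map_zero, zero_mul, Matrix.trace_zero]
  · rw [vecMulVec_star_eq_conjTranspose_mul u x, map_mul, spinEmbed_conjTranspose]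
    exact trace_conjTranspose_mul_self_mul_nonneg hσ _

/-- A density matrix (`σ ⪰ 0`, `tr σ = 1`) has density-matrix marginals. [cite: NielsenChuang2010, §2.4.3] -/
theorem posSemidef_and_trace_spinPartialTrace (φ : X ↪ Y) {σ : Op Y q} (hσ : σ.PosSemidef) (htr : σ.trace = 1) :
    (spinPartialTrace φ σ).PosSemidef ∧ (spinPartialTrace φ σ).trace = 1 :=
  ⟨posSemidef_spinPartialTrace φ hσ, by rw [trace_spinPartialTrace, htr]⟩

/-! ### Functoriality (consistency of marginals), relabellings, covariance -/

/-- **Consistency of marginals** / functoriality: tracing out `Z ∖ X` at once equals tracing out `Z ∖ Y` and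
then `Y ∖ X`: `tr_{ψ.trans φ} = tr_ψ ∘ tr_φ` (the reduced states of one state are compatible,
`ρ^{(m-1)} ← ρ^{(m)}`). [cite: KullEtAl2024, §2.1] -/
theorem spinPartialTrace_trans (ψ : X ↪ Y) (φ : Y ↪ Z) (σ : Op Z q) :
    spinPartialTrace (ψ.trans φ) σ = spinPartialTrace ψ (spinPartialTrace φ σ) := by
  symm
  refine eq_spinPartialTrace_of_forall_trace_mul _ _ fun A => ?_
  rw [trace_mul_spinPartialTrace, trace_mul_spinPartialTrace, spinEmbed_spinEmbed]

/-- The same as an identity of linear maps. [cite: KullEtAl2024, §2.1] -/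
theorem spinPartialTrace_trans_eq_comp (ψ : X ↪ Y) (φ : Y ↪ Z) :
    spinPartialTrace (q := q) (ψ.trans φ) = spinPartialTrace ψ ∘ₗ spinPartialTrace φ :=
  LinearMap.ext fun σ => spinPartialTrace_trans ψ φ σ

/-- The trace is invariant under relabelling the sites (covariance of the local structure under lattice
symmetries). [cite: BratteliRobinsonII1997, §6.2.1] -/
theorem trace_reindexOp (e : X ≃ Y) (M : Op X q) : (reindexOp e M).trace = M.trace := by
  simp only [Matrix.trace, Matrix.diag_apply, reindexOp_apply]
  exact Fintype.sum_equiv (Equiv.arrowCongr e (Equiv.refl (Fin q))).symm _ _ fun σ => rfl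

/-- `reindexOp e⁻¹ ∘ reindexOp e = id`. [folklore] -/
private theorem reindexOp_symm_apply_reindexOp (e : X ≃ Y) (M : Op X q) : reindexOp e.symm (reindexOp e M) = M := by
  ext σ τ
  simp [reindexOp_apply]

/-- **Nothing to trace out**: along a bijection the "partial trace" is the relabelling `reindexOp e⁻¹`.
[cite: BratteliRobinsonII1997, §6.2.1] -/
theorem spinPartialTrace_equiv (e : X ≃ Y) (σ : Op Y q) :
    spinPartialTrace e.toEmbedding σ = reindexOp e.symm σ := by
  symm
  refine eq_spinPartialTrace_of_forall_trace_mul _ _ fun A => ?_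
  rw [spinEmbed_equiv]
  conv_lhs => rw [← reindexOp_symm_apply_reindexOp e A, ← map_mul, trace_reindexOp]

/-- `tr_∅ = id`: the partial trace along the identity injection (nothing traced out) is the identity.
[cite: NielsenChuang2010, §2.4.3] -/
theorem spinPartialTrace_refl (σ : Op X q) : spinPartialTrace (Function.Embedding.refl X) σ = σ := by
  symm
  refine eq_spinPartialTrace_of_forall_trace_mul _ _ fun A => ?_
  rw [spinEmbed_refl]

/-- **Covariance under lattice symmetries**: conjugating the state by the permutation unitary `P_e` of a site
bijection `e` of `Y` and then tracing down to `φ(X)` is tracing the original state down to `e⁻¹(φ(X))`: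
`tr_φ (P_e σ P_eᴴ) = tr_{φ.trans e⁻¹} σ`. [cite: BratteliRobinsonII1997, §6.2.1] -/
theorem spinPartialTrace_permOp_mul_mul_conjTranspose (φ : X ↪ Y) (e : Y ≃ Y) (σ : Op Y q) :
    spinPartialTrace φ (permOp e * σ * (permOp e)ᴴ) = spinPartialTrace (φ.trans e.symm.toEmbedding) σ := by
  refine eq_spinPartialTrace_of_forall_trace_mul _ _ fun A => ?_
  rw [trace_mul_spinPartialTrace, ← permOp_conj_spinEmbed e.symm φ A, conjTranspose_permOp,
    conjTranspose_permOp, Equiv.symm_symm]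
  rw [← mul_assoc, ← mul_assoc, Matrix.trace_mul_comm _ (permOp e.symm), ← mul_assoc, ← mul_assoc]

/-- A state commuting with `P_e` has the same marginal on `φ(X)` and on `e(φ(X))` (after identifying both with
`X` along `φ`, resp. `φ.trans e`): the partial traces along `φ` and `φ.trans e` agree. For the translations of a
ring and a window this is local translation invariance of the reduced states. [cite: KullEtAl2024, §2.1] -/
theorem spinPartialTrace_trans_equiv_of_commute (φ : X ↪ Y) (e : Y ≃ Y) {σ : Op Y q}
    (hσ : Commute (permOp e) σ) : spinPartialTrace (φ.trans e.toEmbedding) σ = spinPartialTrace φ σ := by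
  have hcomm : permOp e.symm * σ = σ * permOp e.symm := by
    have h := hσ.eq
    have h2 := congrArg (fun M => (permOp e)ᴴ * M * (permOp e)ᴴ) h
    simp only [← mul_assoc, conjTranspose_permOp_mul, one_mul] at h2
    rw [mul_assoc ((permOp e)ᴴ * σ), permOp_mul_conjTranspose, mul_one, conjTranspose_permOp] at h2
    exact h2.symm
  have h := spinPartialTrace_permOp_mul_mul_conjTranspose φ e.symm σ
  rw [Equiv.symm_symm, hcomm, mul_assoc, permOp_mul_conjTranspose, mul_one] at h
  exact h.symm

/-! ### Vector states and state functionals -/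

/-- **Reduced density matrix of a vector state**: for `σ = |ψ⟩⟨ψ|` (`vecMulVec ψ ψ̄`) the entries of the
marginal are the expectations of the embedded matrix units, `(tr_{Y∖X} |ψ⟩⟨ψ|)_{ts} = ⟨ψ, Γ_φ(|s⟩⟨t|) ψ⟩`.
[cite: NielsenChuang2010, §2.4.3 eq. (2.178)] -/
theorem spinPartialTrace_vecMulVec_apply (φ : X ↪ Y) (ψ : TensorIndex Y q → ℂ) (t s : TensorIndex X q) :
    spinPartialTrace φ (Matrix.vecMulVec ψ (star ψ)) t s =
      star ψ ⬝ᵥ (spinEmbed φ (Matrix.single s t (1 : ℂ)) *ᵥ ψ) := by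
  rw [spinPartialTrace_apply, Matrix.mul_vecMulVec, Matrix.trace_vecMulVec, dotProduct_comm]

/-- The expectation of a window observable in a vector state is computed by the window marginal:
`tr (A · tr_{Y∖X}|ψ⟩⟨ψ|) = ⟨ψ, (A ⊗ 𝟙) ψ⟩`. [cite: NielsenChuang2010, §2.4.3 eq. (2.180)] -/
theorem trace_mul_spinPartialTrace_vecMulVec (φ : X ↪ Y) (A : Op X q) (ψ : TensorIndex Y q → ℂ) :
    (A * spinPartialTrace φ (Matrix.vecMulVec ψ (star ψ))).trace = star ψ ⬝ᵥ (spinEmbed φ A *ᵥ ψ) := by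
  rw [trace_mul_spinPartialTrace, Matrix.mul_vecMulVec, Matrix.trace_vecMulVec, dotProduct_comm]

/-- `|ψ⟩⟨ψ|` is positive semidefinite, so its marginals are (`posSemidef_spinPartialTrace`): the reduced
density operator of a pure state is a density operator. [cite: NielsenChuang2010, §2.4.3] -/
theorem posSemidef_spinPartialTrace_vecMulVec (φ : X ↪ Y) (ψ : TensorIndex Y q → ℂ) :
    (spinPartialTrace φ (Matrix.vecMulVec ψ (star ψ))).PosSemidef :=
  posSemidef_spinPartialTrace φ (Matrix.posSemidef_vecMulVec_self_star ψ)

/-- **Density matrix of a state functional on a window**: for a linear functional `ω` on `𝔄_Y` (e.g. a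
symmetry-averaged ground-state expectation) and `φ : X ↪ Y`, the operator `ρ ∈ 𝔄_X` with entries
`ρ_{ts} = ω(Γ_φ(|s⟩⟨t|))`, i.e. (`trace_mul_densityAlong`) `tr (A ρ) = ω(A ⊗ 𝟙)` for all `A ∈ 𝔄_X` — the
restriction `ω|_{𝔄_X}` written as a density matrix. [cite: BratteliRobinsonII1997, §6.2.1] -/
def densityAlong (ω : Op Y q →ₗ[ℂ] ℂ) (φ : X ↪ Y) : Op X q :=
  Matrix.of fun t s => ω (spinEmbed φ (Matrix.single s t (1 : ℂ)))

/-- Entries of `densityAlong` (definitional). [cite: BratteliRobinsonII1997, §6.2.1] -/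
theorem densityAlong_apply (ω : Op Y q →ₗ[ℂ] ℂ) (φ : X ↪ Y) (t s : TensorIndex X q) :
    densityAlong ω φ t s = ω (spinEmbed φ (Matrix.single s t (1 : ℂ))) := rfl

/-- **Riesz form of the restricted state**: `tr (A · densityAlong ω φ) = ω (Γ_φ A)` for every `A ∈ 𝔄_X`.
[cite: BratteliRobinsonII1997, §6.2.1] -/
theorem trace_mul_densityAlong (ω : Op Y q →ₗ[ℂ] ℂ) (φ : X ↪ Y) (A : Op X q) :
    (A * densityAlong ω φ).trace = ω (spinEmbed φ A) := by
  conv_rhs => rw [Matrix.matrix_eq_sum_single A]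
  simp only [map_sum]
  rw [Matrix.trace]
  simp only [Matrix.diag_apply, Matrix.mul_apply]
  refine Finset.sum_congr rfl fun s _ => Finset.sum_congr rfl fun t _ => ?_
  have h1 : Matrix.single s t (A s t) = A s t • Matrix.single s t (1 : ℂ) := by
    rw [Matrix.smul_single, smul_eq_mul, mul_one]
  rw [h1, map_smul, map_smul, smul_eq_mul, densityAlong_apply]

/-- The tracial functional `A ↦ tr (A σ)` restricted along `φ` is the partial trace of `σ`:
`densityAlong (tr(· σ)) φ = tr_{Y∖X} σ`. [cite: NielsenChuang2010, §2.4.3] -/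
theorem densityAlong_traceForm (σ : Op Y q) (φ : X ↪ Y) :
    densityAlong ((Matrix.traceLinearMap _ ℂ ℂ).comp (LinearMap.mulRight ℂ σ)) φ = spinPartialTrace φ σ := by
  ext t s
  rw [densityAlong_apply, spinPartialTrace_apply]
  rfl

/-- A positive linear functional on `𝔄_Y` is real on Hermitian elements (`4H = (H+1)ᴴ(H+1) − (H−1)ᴴ(H−1)`).
[cite: BratteliRobinsonI1987, Lemma 2.3.10] -/
theorem im_apply_eq_zero_of_isHermitian (ω : Op Y q →ₗ[ℂ] ℂ) (hpos : ∀ B : Op Y q, 0 ≤ ω (Bᴴ * B))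
    {H : Op Y q} (hH : H.IsHermitian) : (ω H).im = 0 := by
  have h₁ := hpos (H + 1)
  have h₂ := hpos (H - 1)
  rw [conjTranspose_add, conjTranspose_one, hH.eq] at h₁
  rw [conjTranspose_sub, conjTranspose_one, hH.eq] at h₂
  have key : (H + 1) * (H + 1) - (H - 1) * (H - 1) = 4 • H := by noncomm_ring
  have h : (4 • ω H).im = (ω ((H + 1) * (H + 1))).im - (ω ((H - 1) * (H - 1))).im := by
    rw [← map_nsmul, ← key, map_sub, Complex.sub_im]
  simp only [← (Complex.nonneg_iff.1 h₁).2, ← (Complex.nonneg_iff.1 h₂).2, sub_zero,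
    nsmul_eq_mul, Nat.cast_ofNat, Complex.mul_im, Complex.re_ofNat, Complex.im_ofNat, zero_mul,
    add_zero] at h
  linarith

/-- **A positive linear functional is Hermitian**: `ω(Aᴴ) = conj ω(A)`. [cite: BratteliRobinsonI1987, Prop. 2.3.11] -/
theorem apply_conjTranspose_of_nonneg (ω : Op Y q →ₗ[ℂ] ℂ) (hpos : ∀ B : Op Y q, 0 ≤ ω (Bᴴ * B))
    (A : Op Y q) : ω Aᴴ = star (ω A) := by
  have h₁ : (ω (A + Aᴴ)).im = 0 :=
    im_apply_eq_zero_of_isHermitian ω hpos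
      (by rw [IsHermitian, conjTranspose_add, conjTranspose_conjTranspose, add_comm])
  have h₂ : (ω (Complex.I • (A - Aᴴ))).im = 0 :=
    im_apply_eq_zero_of_isHermitian ω hpos
      (by rw [IsHermitian, conjTranspose_smul, conjTranspose_sub, conjTranspose_conjTranspose,
            Complex.star_def, Complex.conj_I, neg_smul, ← smul_neg, neg_sub])
  rw [map_add, Complex.add_im] at h₁
  rw [map_smul, map_sub, smul_eq_mul, Complex.mul_im, Complex.I_re, Complex.I_im, zero_mul, zero_add,
    one_mul, Complex.sub_re] at h₂
  apply Complex.ext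
  · rw [Complex.star_def, Complex.conj_re]; linarith
  · rw [Complex.star_def, Complex.conj_im]; linarith

/-- The density matrix of a POSITIVE functional is Hermitian. [cite: BratteliRobinsonI1987, Prop. 2.3.11] -/
theorem isHermitian_densityAlong (ω : Op Y q →ₗ[ℂ] ℂ) (hpos : ∀ B : Op Y q, 0 ≤ ω (Bᴴ * B)) (φ : X ↪ Y) :
    (densityAlong ω φ).IsHermitian := by
  ext t s
  rw [Matrix.conjTranspose_apply, densityAlong_apply, densityAlong_apply, ← apply_conjTranspose_of_nonneg ω hpos,
    ← spinEmbed_conjTranspose, Matrix.conjTranspose_single, star_one]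

/-- **The density matrix of a positive functional is positive semidefinite**:
`xᴴ ρ x = ω(Γ_φ(|x⟩⟨x|)) = ω((Γ_φ B)ᴴ (Γ_φ B)) ≥ 0`. [cite: BratteliRobinsonII1997, §6.2.1] -/
theorem posSemidef_densityAlong (ω : Op Y q →ₗ[ℂ] ℂ) (hpos : ∀ B : Op Y q, 0 ≤ ω (Bᴴ * B)) (φ : X ↪ Y) :
    (densityAlong ω φ).PosSemidef := by
  refine Matrix.PosSemidef.of_dotProduct_mulVec_nonneg (isHermitian_densityAlong ω hpos φ) fun x => ?_
  have h1 : star x ⬝ᵥ (densityAlong ω φ *ᵥ x) = (Matrix.vecMulVec x (star x) * densityAlong ω φ).trace := by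
    rw [Matrix.trace_mul_comm, Matrix.mul_vecMulVec, Matrix.trace_vecMulVec, dotProduct_comm]
  rw [h1, trace_mul_densityAlong]
  rcases isEmpty_or_nonempty (TensorIndex X q) with hE | ⟨⟨u⟩⟩
  · have h0 : Matrix.vecMulVec x (star x) = 0 := by ext i; exact isEmptyElim i
    rw [h0, map_zero, map_zero]
  · rw [vecMulVec_star_eq_conjTranspose_mul u x, map_mul, spinEmbed_conjTranspose]
    exact hpos _

/-- A normalised positive functional (`ω(𝟙) = 1`) restricts to a DENSITY MATRIX on every window:
`ρ ⪰ 0`, `tr ρ = 1`. [cite: BratteliRobinsonII1997, §6.2.1] -/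
theorem posSemidef_and_trace_densityAlong (ω : Op Y q →ₗ[ℂ] ℂ) (hpos : ∀ B : Op Y q, 0 ≤ ω (Bᴴ * B))
    (hone : ω 1 = 1) (φ : X ↪ Y) : (densityAlong ω φ).PosSemidef ∧ (densityAlong ω φ).trace = 1 := by
  refine ⟨posSemidef_densityAlong ω hpos φ, ?_⟩
  have h := trace_mul_densityAlong ω φ 1
  rwa [one_mul, map_one, hone] at h

/-- **Consistency of the restricted states**: `tr_{Y∖X} (densityAlong ω φ) = densityAlong ω (ψ.trans φ)` —
restricting `ω` to `𝔄_Y'` (`φ : Y' ↪ Y`) and tracing down to `X` (`ψ : X ↪ Y'`) is restricting to `𝔄_X`.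
[cite: BratteliRobinsonII1997, §6.2.1] -/
theorem spinPartialTrace_densityAlong {Y' : Type*} [Fintype Y'] [DecidableEq Y'] (ω : Op Y q →ₗ[ℂ] ℂ)
    (ψ : X ↪ Y') (φ : Y' ↪ Y) : spinPartialTrace ψ (densityAlong ω φ) = densityAlong ω (ψ.trans φ) := by
  ext t s
  rw [spinPartialTrace_apply, trace_mul_densityAlong, spinEmbed_spinEmbed, densityAlong_apply]

/-- **Covariance of the restricted states**: if `ω` is invariant under conjugation by the permutation unitary of
a site bijection `e` (`ω(P_e A P_eᴴ) = ω(A)`), its density matrices along `φ` and `φ.trans e` coincide.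
[cite: BratteliRobinsonII1997, §6.2.1] -/
theorem densityAlong_trans_equiv_of_invariant (ω : Op Y q →ₗ[ℂ] ℂ) (e : Y ≃ Y)
    (hω : ∀ A : Op Y q, ω (permOp e * A * (permOp e)ᴴ) = ω A) (φ : X ↪ Y) :
    densityAlong ω (φ.trans e.toEmbedding) = densityAlong ω φ := by
  ext t s
  rw [densityAlong_apply, densityAlong_apply, ← permOp_conj_spinEmbed, hω]

end PartialTrace

/-! ### Chains: tracing out the leftmost / rightmost site of a window, and the LTI condition -/

section Chain

variable {Y : Type*} [Fintype Y] [DecidableEq Y] {q n : ℕ}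

/-- Off the range of `Fin.succ` two configurations agree iff they agree at `0`. [folklore] -/
private theorem agree_off_range_succ_iff {α : Type*} (σ τ : Fin (n + 1) → α) :
    (∀ y, y ∉ Set.range (Fin.succ : Fin n → Fin (n + 1)) → σ y = τ y) ↔ σ 0 = τ 0 := by
  constructor
  · intro h
    exact h 0 fun ⟨i, hi⟩ => Fin.succ_ne_zero i hi
  · intro h y hy
    rcases Fin.eq_zero_or_eq_succ y with rfl | ⟨j, rfl⟩
    · exact h
    · exact absurd ⟨j, rfl⟩ hy

/-- Off the range of `Fin.castSucc` two configurations agree iff they agree at `Fin.last n`. [folklore] -/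
private theorem agree_off_range_castSucc_iff {α : Type*} (σ τ : Fin (n + 1) → α) :
    (∀ y, y ∉ Set.range (Fin.castSucc : Fin n → Fin (n + 1)) → σ y = τ y) ↔
      σ (Fin.last n) = τ (Fin.last n) := by
  constructor
  · intro h
    exact h (Fin.last n) fun ⟨i, hi⟩ => Fin.castSucc_ne_last i hi
  · intro h y hy
    rcases Fin.eq_castSucc_or_eq_last y with ⟨j, rfl⟩ | rfl
    · exact absurd ⟨j, rfl⟩ hy
    · exact h

/-- Double sums over `(n+1)`-site configurations, split at site `0`. [folklore] -/
private theorem sum_sum_cons (G : (Fin (n + 1) → Fin q) → (Fin (n + 1) → Fin q) → ℂ) :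
    ∑ σ', ∑ τ', G σ' τ' =
      ∑ a : Fin q, ∑ s' : Fin n → Fin q, ∑ b : Fin q, ∑ t' : Fin n → Fin q, G (Fin.cons a s') (Fin.cons b t') := by
  rw [← (Fin.consEquiv fun _ => Fin q).sum_comp, Fintype.sum_prod_type]
  refine Finset.sum_congr rfl fun a _ => Finset.sum_congr rfl fun s' _ => ?_
  rw [← (Fin.consEquiv fun _ => Fin q).sum_comp, Fintype.sum_prod_type]
  rfl

/-- Double sums over `(n+1)`-site configurations, split at site `last n`. [folklore] -/
private theorem sum_sum_snoc (G : (Fin (n + 1) → Fin q) → (Fin (n + 1) → Fin q) → ℂ) :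
    ∑ σ', ∑ τ', G σ' τ' =
      ∑ a : Fin q, ∑ s' : Fin n → Fin q, ∑ b : Fin q, ∑ t' : Fin n → Fin q, G (Fin.snoc s' a) (Fin.snoc t' b) := by
  rw [← (Fin.snocEquiv fun _ => Fin q).sum_comp, Fintype.sum_prod_type]
  refine Finset.sum_congr rfl fun a _ => Finset.sum_congr rfl fun s' _ => ?_
  rw [← (Fin.snocEquiv fun _ => Fin q).sum_comp, Fintype.sum_prod_type]
  rfl

/-- **`tr_L`, tracing out the LEFTMOST site** of an `(n+1)`-site window is the partial trace along
`Fin.succEmb n : Fin n ↪ Fin (n+1)`; entrywise `(tr_L ρ)_{ts} = Σ_a ρ_{(a,t),(a,s)}` (`Fin.cons`).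
[cite: KullEtAl2024, §2.1 (the LTI condition)] -/
theorem spinPartialTrace_succEmb_apply (ρ : Op (Fin (n + 1)) q) (t s : TensorIndex (Fin n) q) :
    spinPartialTrace (Fin.succEmb n) ρ t s = ∑ a : Fin q, ρ (Fin.cons a t) (Fin.cons a s) := by
  rw [spinPartialTrace_apply, Matrix.trace]
  simp only [Matrix.diag_apply, Matrix.mul_apply, spinEmbed_apply, Fin.coe_succEmb, agree_off_range_succ_iff,
    Matrix.single_apply]
  rw [sum_sum_cons]
  simp only [Fin.cons_zero, Fin.cons_succ, ite_and, ite_mul, one_mul, zero_mul, Finset.sum_ite_irrel,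
    Finset.sum_const_zero, Finset.sum_ite_eq, Finset.mem_univ, if_true]

/-- **`tr_R`, tracing out the RIGHTMOST site**: the partial trace along `Fin.castSuccEmb : Fin n ↪ Fin (n+1)`;
entrywise `(tr_R ρ)_{ts} = Σ_a ρ_{(t,a),(s,a)}` (`Fin.snoc`). [cite: KullEtAl2024, §2.1 (the LTI condition)] -/
theorem spinPartialTrace_castSuccEmb_apply (ρ : Op (Fin (n + 1)) q) (t s : TensorIndex (Fin n) q) :
    spinPartialTrace Fin.castSuccEmb ρ t s = ∑ a : Fin q, ρ (Fin.snoc t a) (Fin.snoc s a) := by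
  rw [spinPartialTrace_apply, Matrix.trace]
  simp only [Matrix.diag_apply, Matrix.mul_apply, spinEmbed_apply, Fin.coe_castSuccEmb,
    agree_off_range_castSucc_iff, Matrix.single_apply]
  rw [sum_sum_snoc]
  simp only [Fin.snoc_last, Fin.snoc_castSucc, ite_and, ite_mul, one_mul, zero_mul, Finset.sum_ite_irrel,
    Finset.sum_const_zero, Finset.sum_ite_eq, Finset.mem_univ, if_true]

/-- **Window marginals of an invariant state are locally translation invariant (LTI).** Let `ι` place an
`(n+1)`-site window in `Y` and let the site bijection `e` shift it by one site (`e (ι i) = ι (i+1)` on the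
first `n` sites). If the state `σ` commutes with `P_e` (e.g. a translation-invariant state of a ring), then the
window marginal `ρ^{(n+1)} = tr_{Y∖window} σ` satisfies `tr_L ρ^{(n+1)} = tr_R ρ^{(n+1)}` — the LTI
condition that makes the reduced states of a translation-invariant state feasible for the LTI problem.
[cite: KullEtAl2024, §2.1–2.2] -/
theorem spinPartialTrace_succ_eq_castSucc_of_commute (ι : Fin (n + 1) ↪ Y) (e : Y ≃ Y)
    (he : ∀ i : Fin n, e (ι i.castSucc) = ι i.succ) {σ : Op Y q} (hσ : Commute (permOp e) σ) :
    spinPartialTrace (Fin.succEmb n) (spinPartialTrace ι σ) =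
      spinPartialTrace Fin.castSuccEmb (spinPartialTrace ι σ) := by
  have hemb : (Fin.succEmb n).trans ι = (Fin.castSuccEmb.trans ι).trans e.toEmbedding := by
    ext i
    simp [Function.Embedding.trans_apply, he]
  rw [← spinPartialTrace_trans, ← spinPartialTrace_trans, hemb, spinPartialTrace_trans_equiv_of_commute _ _ hσ]

/-- The same for a state functional invariant under `P_e`-conjugation: its window density matrix is LTI.
[cite: KullEtAl2024, §2.1–2.2] -/
theorem spinPartialTrace_succ_densityAlong_eq_of_invariant (ω : Op Y q →ₗ[ℂ] ℂ) (ι : Fin (n + 1) ↪ Y)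
    (e : Y ≃ Y) (he : ∀ i : Fin n, e (ι i.castSucc) = ι i.succ)
    (hω : ∀ A : Op Y q, ω (permOp e * A * (permOp e)ᴴ) = ω A) :
    spinPartialTrace (Fin.succEmb n) (densityAlong ω ι) = spinPartialTrace Fin.castSuccEmb (densityAlong ω ι) := by
  have hemb : (Fin.succEmb n).trans ι = (Fin.castSuccEmb.trans ι).trans e.toEmbedding := by
    ext i
    simp [Function.Embedding.trans_apply, he]
  rw [spinPartialTrace_densityAlong, spinPartialTrace_densityAlong, hemb,
    densityAlong_trans_equiv_of_invariant ω e hω]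

end Chain

end Literature.MathematicalPhysics.QuantumLattice
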